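import Summits.ResolutionOfSingularities.ResolutionOfSingularities.Theorems.FrobeniusLadderFRationalResolutionPrimaryCentreAtIsolatedPoint
import Summits.ResolutionOfSingularities.ResolutionOfSingularities.Theorems.FrobeniusLadderFRationalResolutionRegularFaceOfOrthantLike
import Mathlib.RingTheory.KrullDimension.Basic
import HarnessLib

/-!
# Crux `FrobeniusLadder.FRationalResolution` (stmt-ResolutionOfSingularities-15317), line `redirect`,
# stub `stub_diagonalizableQuotientResolution` — (κ″) at a «fixed» point of a log regular chart, a REGULAR point means a
# REGULAR cone; hence at an ISOLATED singular fixed point the Kato ideal is `𝔮`-primary and `dim A_𝔮 = n` (the hypothesis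
# `hdim` of (ε₂′)/(ε₂″) DERIVED from isolatedness)

Converse of `…RegularConeRegularPoint` (κ′, ✓ p824046). Let `φ : P → A` (`P ⊆ ℤⁿ` finitely generated, saturated, spanning;
`A` Noetherian) be log regular at the prime `𝔮` with unit face `0` (`φ(P ∖ 0) ⊆ 𝔮`). (1) If `A_𝔮` is a regular local ring
then the face fan of `P^∨` is REGULAR: Kato's criterion (`LogChart.exists_generators_mod_faceMonoid_of_isRegularLocalRing`,
✓ p823471) makes `P` orthant-like (`…OrthantLikeOfGenerators`, ✓ p823523), whose orthogonal face (`…RegularFaceOfOrthantLike`,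
✓ p823861) is a regular face `τ` of `P^∨` containing every `v ∈ P^∨` orthogonal to the unit face — i.e. all of `P^∨` when the
face is `0`; faces of a regular cone are regular. (2) Consequently, if `φ` is log regular at every prime, the face fan is NOT
regular and every prime `𝔓 ≠ 𝔮` is a regular point (an isolated singular fixed point), then no prime strictly inside `𝔮`
contains the Kato ideal `I(𝔮)` (such a prime would again have unit face `0`, be regular, and force a regular fan), so
`A_𝔮 / I(𝔮)A_𝔮` — a regular local ring by (2.1)(i) — is zero-dimensional and (2.1)(ii) reads `dim A_𝔮 = n`.

* `isRegular_ofCone_of_isRegularLocalRing` — (1);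
* `face_eq_of_ideal_le` — unit face `0` at `𝔮` and `I(𝔮) ⊆ 𝔓` ⇒ unit face `0` at `𝔓`;
* **`ringKrullDim_eq_of_isolated`** — (2): `ringKrullDim A_𝔮 = n`.

Honest label: dictionary brick (no stub closed); removes the hypothesis `hdim` from the isolated-singularity assemblies. No
definitions, no named facts, no sorry. [cite: Kato1994, Def. (2.1), (6.1), (10.4)] [cite: Fulton1993Toric, §1.3, §2.1]
-/

noncomputable section

-- single-problem summit: the doubled namespace component is forced
set_option linter.dupNamespace false

open IsLocalRing
open Literature.AlgebraicGeometry.Resolution Literature.Geometry.PolyhedralFans PointedCone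
open Literature.Combinatorics.Optimization.HilbertBasis (toRat toRat_zero)
open Literature.AlgebraicGeometry.Resolution.LogBlowup Literature.AlgebraicGeometry.Resolution.LogChart
open Summit.ResolutionOfSingularities.ResolutionOfSingularities.Theorems.FRationalResolution

namespace Summit.ResolutionOfSingularities.ResolutionOfSingularities.Theorems.FRationalResolution.RegularPointRegularCone

variable {n : ℕ} {A : Type} [CommRing A] {P : AddSubmonoid (Fin n → ℤ)} {φ : Multiplicative P →* A}

/-- **(κ″) Regular point with unit face `0` ⇒ regular face fan.** [cite: Kato1994, Def. (2.1), (10.4)]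
[cite: Fulton1993Toric, §1.3, §2.1] -/
theorem isRegular_ofCone_of_isRegularLocalRing [IsNoetherianRing A] (hP : P.FG)
    (hsat : ∀ (v : Fin n → ℤ) (k : ℕ), 0 < k → k • v ∈ P → v ∈ P)
    (hspan : Submodule.span ℤ (P : Set (Fin n → ℤ)) = ⊤)
    (𝔮 : Ideal A) [𝔮.IsPrime] (hreg : IsLogRegularAt P φ 𝔮)
    (hfix : ∀ p : P, (p : Fin n → ℤ) ≠ 0 → φ (Multiplicative.ofAdd p) ∈ 𝔮)
    (hR : IsRegularLocalRing (Localization.AtPrime 𝔮)) :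
    (Fan.ofCone (dualCone P) (dualCone_fg P hP) (isSalient_dualCone P hspan)).IsRegular := by
  classical
  -- Kato's criterion and the orthant-like adapter (as in `…PrimaryCentreAtIsolatedPoint`)
  obtain ⟨Q, -, hQcard, hQgen⟩ :=
    exists_generators_mod_faceMonoid_of_isRegularLocalRing (φ := φ) (𝔭 := 𝔮) hP hsat hreg hR
  set M : Submodule ℤ (Fin n → ℤ) :=
    Submodule.span ℤ ((fun p : P => (p : Fin n → ℤ)) '' face P φ 𝔮) with hMdef
  have hMeq : Submodule.span ℤ (faceMonoid P φ 𝔮 : Set (Fin n → ℤ)) = M := by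
    rw [hMdef, PrimaryCentreAtIsolatedPoint.coe_image_face_eq]
  let Q' : Finset (Fin n → ℤ) := Q.image (fun q : P => (q : Fin n → ℤ))
  have hQ'P : ∀ q ∈ Q', q ∈ P := by
    intro q hq
    obtain ⟨q₀, -, rfl⟩ := Finset.mem_image.1 hq
    exact q₀.2
  have hQ'card : Q'.card ≤ n - Module.finrank ℤ M := le_trans Finset.card_image_le hQcard
  have hQ'gen : ∀ p ∈ P, ∃ c : (Fin n → ℤ) → ℕ, p - ∑ q ∈ Q', c q • q ∈ M := by
    intro p hp
    obtain ⟨c, hc⟩ := hQgen ⟨p, hp⟩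
    refine ⟨fun v => if h : v ∈ P then c ⟨v, h⟩ else 0, ?_⟩
    have hsum : ∑ q ∈ Q', (fun v => if h : v ∈ P then c ⟨v, h⟩ else 0) q • q =
        ∑ q ∈ Q, c q • (q : Fin n → ℤ) := by
      rw [Finset.sum_image (fun x _ y _ h => Subtype.ext h)]
      refine Finset.sum_congr rfl fun q _ => ?_
      show (if h : ((q : P) : Fin n → ℤ) ∈ P then c ⟨(q : Fin n → ℤ), h⟩ else 0) • ((q : P) : Fin n → ℤ) = _
      rw [dif_pos q.2]
    rw [hsum, ← hMeq]
    exact hc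
  obtain ⟨b, I, hOL⟩ :=
    OrthantLikeOfGenerators.isOrthantLike_sup_of_generators_mod P hspan M Q' hQ'P hQ'card hQ'gen
  -- the regular orthogonal face contains all of `P^∨` (the unit face is `0`)
  have hFP : (fun p : P => (p : Fin n → ℤ)) '' face P φ 𝔮 ⊆ (P : Set (Fin n → ℤ)) := by
    rintro _ ⟨q, -, rfl⟩; exact q.2
  obtain ⟨τ, T, hT, hTreg, hface, hperpτ⟩ :=
    RegularFaceOfOrthantLike.exists_regular_face_of_isOrthantLike P _ hFP hOL
  have hface0 : ∀ q ∈ face P φ 𝔮, (q : Fin n → ℤ) = 0 := by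
    intro q hq
    by_contra hne
    exact (mem_face_iff.1 hq) (hfix q hne)
  have hτeq : τ = dualCone P := by
    refine le_antisymm hface.le fun v hv => hperpτ v hv ?_
    rintro _ ⟨q, hq, rfl⟩
    show toRat (q : Fin n → ℤ) ⬝ᵥ v = 0
    rw [hface0 q hq, toRat_zero, zero_dotProduct]
  -- faces of the regular cone `P^∨ = hull T` are regular
  intro ρ hρ
  rw [Fan.mem_ofCone_iff, ← hτeq, hT.2.2] at hρ
  refine ⟨T.filter (· ∈ ρ), hTreg.mono (Finset.filter_subset _ _), ?_⟩
  exact eq_hull_filter_of_isFaceOf_hull hρ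

/-- **Unit face `0` propagates to every prime containing the Kato ideal.** If `φ(P ∖ 0) ⊆ 𝔮` and `I(𝔮) ⊆ 𝔓` then
`φ(P ∖ 0) ⊆ 𝔓`. [cite: Kato1994, Def. (2.1)] -/
theorem hfix_of_ideal_le (𝔮 𝔓 : Ideal A)
    (hfix : ∀ p : P, (p : Fin n → ℤ) ≠ 0 → φ (Multiplicative.ofAdd p) ∈ 𝔮) (hI : ideal P φ 𝔮 ≤ 𝔓) :
    ∀ p : P, (p : Fin n → ℤ) ≠ 0 → φ (Multiplicative.ofAdd p) ∈ 𝔓 := fun p hp =>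
  hI (Ideal.subset_span ⟨p, hfix p hp, rfl⟩)

/-- **At an isolated singular «fixed» point the Kato ideal is `𝔮`-primary and `dim A_𝔮 = n`.** `φ : P → A` fs spanning,
log regular at every prime of the Noetherian ring `A`; `𝔮` a prime with `φ(P ∖ 0) ⊆ 𝔮`, every prime `≠ 𝔮` a regular point,
and the face fan of `P^∨` not regular. Then `ringKrullDim A_𝔮 = n`. [cite: Kato1994, Def. (2.1), (6.1), (10.4)] -/
theorem ringKrullDim_eq_of_isolated [IsNoetherianRing A] (hP : P.FG)
    (hsat : ∀ (v : Fin n → ℤ) (k : ℕ), 0 < k → k • v ∈ P → v ∈ P)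
    (hspan : Submodule.span ℤ (P : Set (Fin n → ℤ)) = ⊤)
    (hreg : ∀ (𝔭 : Ideal A) [𝔭.IsPrime], IsLogRegularAt P φ 𝔭)
    (𝔮 : Ideal A) [𝔮.IsPrime] (hfix : ∀ p : P, (p : Fin n → ℤ) ≠ 0 → φ (Multiplicative.ofAdd p) ∈ 𝔮)
    (hisol : ∀ (𝔓 : Ideal A) [𝔓.IsPrime], 𝔓 ≠ 𝔮 → IsRegularLocalRing (Localization.AtPrime 𝔓))
    (hnreg : ¬ (Fan.ofCone (dualCone P) (dualCone_fg P hP) (isSalient_dualCone P hspan)).IsRegular) :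
    ringKrullDim (Localization.AtPrime 𝔮) = n := by
  classical
  set R := Localization.AtPrime 𝔮 with hRdef
  set I : Ideal R := (ideal P φ 𝔮).map (algebraMap A R) with hIdef
  obtain ⟨hquot, hdimeq⟩ := hreg 𝔮
  haveI : IsRegularLocalRing (R ⧸ I) := hquot
  -- (a) the unit face at `𝔮` is `0`, so its span has rank `0`
  have hface : (fun p : P => (p : Fin n → ℤ)) '' face P φ 𝔮 = {0} := by
    ext v
    simp only [Set.mem_image, mem_face_iff, Set.mem_singleton_iff]
    constructor
    · rintro ⟨p, hp, rfl⟩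
      by_contra hv
      exact hp (hfix p hv)
    · rintro rfl
      refine ⟨0, ?_, rfl⟩
      rw [ofAdd_zero, map_one]
      exact fun h1 => ‹𝔮.IsPrime›.ne_top ((Ideal.eq_top_iff_one 𝔮).mpr h1)
  have hrank : Module.finrank ℤ (Submodule.span ℤ ((fun p : P => (p : Fin n → ℤ)) '' face P φ 𝔮)) = 0 := by
    rw [hface, Submodule.span_zero_singleton, finrank_bot]
  -- (b) every prime of `R` containing `I` is the maximal ideal
  have hprimes : ∀ (𝔓' : Ideal R) [𝔓'.IsPrime], I ≤ 𝔓' → 𝔓' = maximalIdeal R := by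
    intro 𝔓' _ hI𝔓'
    set 𝔓 : Ideal A := 𝔓'.comap (algebraMap A R) with h𝔓def
    have h𝔓𝔮 : 𝔓 ≤ 𝔮 := fun a ha => by
      by_contra hane
      have hu : IsUnit (algebraMap A R a) := IsLocalization.map_units R (⟨a, hane⟩ : 𝔮.primeCompl)
      exact (inferInstance : 𝔓'.IsPrime).ne_top (Ideal.eq_top_of_isUnit_mem _ ha hu)
    have hI𝔓 : ideal P φ 𝔮 ≤ 𝔓 := by
      rw [h𝔓def, ← Ideal.map_le_iff_le_comap]
      exact hI𝔓'
    by_cases h𝔓eq : 𝔓 = 𝔮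
    · -- `𝔓' = 𝔓 R = 𝔮 R = 𝔪`
      have h1 : 𝔓' = 𝔓.map (algebraMap A R) :=
        (IsLocalization.map_under 𝔮.primeCompl R 𝔓').symm
      rw [h1, h𝔓eq, Localization.AtPrime.map_eq_maximalIdeal]
    · -- a prime strictly inside `𝔮` containing `I(𝔮)`: regular point with unit face `0` ⇒ regular fan
      exfalso
      haveI hR𝔓 := hisol 𝔓 h𝔓eq
      exact hnreg (isRegular_ofCone_of_isRegularLocalRing hP hsat hspan 𝔓 (hreg 𝔓)
        (hfix_of_ideal_le 𝔮 𝔓 hfix hI𝔓) hR𝔓)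
  -- (c) `R / I` is zero-dimensional
  have hdim0 : ringKrullDim (R ⧸ I) = 0 := by
    haveI : Ring.KrullDimLE 0 (R ⧸ I) := by
      rw [Ring.krullDimLE_zero_iff]
      intro J hJ
      have hJ' : (J.comap (Ideal.Quotient.mk I)) = maximalIdeal R :=
        hprimes _ (le_trans (by rw [← RingHom.ker_eq_comap_bot, Ideal.mk_ker]) (Ideal.comap_mono bot_le))
      have hmax : (maximalIdeal R).IsMaximal := maximalIdeal.isMaximal R
      have hJeq : J = (maximalIdeal R).map (Ideal.Quotient.mk I) := by
        rw [← hJ', Ideal.map_comap_of_surjective _ Ideal.Quotient.mk_surjective]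
      rcases Ideal.map_eq_top_or_isMaximal_of_surjective (Ideal.Quotient.mk I) Ideal.Quotient.mk_surjective hmax with
        htop | hm
      · exact absurd (hJeq.trans htop) hJ.ne_top
      · rw [hJeq]; exact hm
    apply le_antisymm
    · exact Ring.krullDimLE_iff.mp inferInstance
    · exact ringKrullDim_nonneg_of_nontrivial
  -- (d) Kato's (2.1)(ii)
  rw [hdimeq, hdim0, hrank, Nat.sub_zero, zero_add]

end Summit.ResolutionOfSingularities.ResolutionOfSingularities.Theorems.FRationalResolution.RegularPointRegularCone

end
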